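import Literature.AlgebraicGeometry.HodgeTheory.AlgebraicityLocusCurves
import Literature.Topology.KrullDimensionDrop
import HarnessLib

/-!
# The codimension input of the structure theorem on algebraicity loci, from Chevalley's theorem

Topic `Literature/AlgebraicGeometry/HodgeTheory` (family `hodge`), part of the proof programme
of the named fact `charlesSchnell_algebraicityLocus_iUnion_closed` (Charles–Schnell 2014, proof of
Prop. 11.3.11; Voisin, *Hodge Theory II*, §3.3.1, §7.3.2). Its assembly
(`algebraicityLocus_eq_iUnion_of_dichotomy`, `AlgebraicityLocusAssembly`) needs, on every
irreducible closed subset `Y` of a parameter space `T` of supports `𝒵 ⊆ 𝒳 × T`, a non-empty open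
part on which the CODIMENSION CONDITION "every point `x` with `(x, y) ∈ 𝒵` has
`height x + p ≤ n`" holds at all complex points or at none. This file derives that generic
uniformity from CHEVALLEY'S UPPER SEMICONTINUITY OF FIBRE DIMENSION in its printed form for the
projection `𝒵 → T` (EGA IV₃ 13.1.5: for a proper morphism `π`, `y ↦ dim π⁻¹(y)` is upper
semicontinuous, i.e. `{y | dim π⁻¹(y) < k}` is open for every `k`; here `π⁻¹(y)` is the subspace
`{w ∈ 𝒵 | pr_T w = y}` and `dim` is `topologicalKrullDim`), taken as a hypothesis:

* `le_topologicalKrullDim_of_le_height`, `exists_le_height_of_le_topologicalKrullDim`,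
  `topologicalKrullDim_lt_iff_forall_height_lt` — a closed subset of a scheme has dimension `< k`
  iff all its points have height (`= dim closure {x}`) `< k` (chains of specialisations below a
  point of a closed set stay in it; generic points of chains of irreducible closed subsets);
* `topologicalKrullDim_fibre_lt_iff` — over a complex point `y`, `dim {w ∈ 𝒵 | pr_T w = pt y} < k`
  iff every `x` with `i_y(x) ∈ 𝒵` has `height x < k` (the fibre is the slice,
  `exists_sliceAt_base_eq`, `height_sliceAt_base_eq`);
* `codim_dichotomy_of_upperSemicontinuous` — the generic uniformity of the codimension condition
  on irreducible closed `Y ⊆ T`, for one closed `𝒵 ⊆ 𝒳 × T`, from the semicontinuity.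

## References

* [EGAIV3] A. Grothendieck, J. Dieudonné, Éléments de géométrie algébrique IV₃, Publ. Math. IHÉS 28
  (1966), Thm. 13.1.3, Cor. 13.1.5.
* [CharlesSchnell2014Notes] F. Charles, C. Schnell, Notes on absolute Hodge classes (2014),
  Prop. 11.3.11 (proof).
* [Hartshorne1977] R. Hartshorne, Algebraic Geometry (1977), II Ex. 3.22 (dimension of fibres).
-/

noncomputable section

open CategoryTheory AlgebraicGeometry Limits Set Order MonoidalCategory CartesianMonoidalCategory
open _root_.Topology TopologicalSpace
open Literature.AlgebraicGeometry.Motives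

namespace Literature.AlgebraicGeometry.HodgeTheory

section HodgeTheory


/-! ### Dimension of a closed subset of a scheme and heights of its points -/

/-- A closed subset `F` of a scheme containing a point of height `≥ k` (a chain of `k`
specialisations below it, all in `F`) has dimension `≥ k`. [folklore] -/
theorem le_topologicalKrullDim_of_le_height {W : Scheme} {F : Set W} (hF : IsClosed F) {w : W}
    (hw : w ∈ F) {k : ℕ} (hk : (k : ℕ∞) ≤ height w) :
    (k : WithBot ℕ∞) ≤ topologicalKrullDim F := by
  obtain ⟨p, hlast, hlen⟩ := Order.exists_series_of_le_height w hk
  have hmem : ∀ i, p i ∈ F := fun i => by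
    have h1 : p i ≤ w := hlast ▸ p.monotone (Fin.le_last i)
    exact Specializes.mem_closed (show w ⤳ p i from h1) hF hw
  -- the closures in `F` of the points of the chain, a chain of irreducible closed subsets of `F`
  let cl : Fin (p.length + 1) → IrreducibleCloseds F := fun i =>
    { carrier := closure {(⟨p i, hmem i⟩ : F)}
      isIrreducible' := isIrreducible_singleton.closure
      isClosed' := isClosed_closure }
  have hstep : ∀ i : Fin p.length, cl (Fin.castSucc i) < cl i.succ := fun i => by
    have h := p.step i
    change (p i.succ ⤳ p (Fin.castSucc i)) ∧ ¬ (p (Fin.castSucc i) ⤳ p i.succ) at h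
    rw [← subtype_specializes_iff (⟨p i.succ, hmem _⟩ : F) ⟨p (Fin.castSucc i), hmem _⟩,
      ← subtype_specializes_iff (⟨p (Fin.castSucc i), hmem _⟩ : F) ⟨p i.succ, hmem _⟩,
      specializes_iff_closure_subset, specializes_iff_closure_subset] at h
    refine lt_of_le_of_ne h.1 fun heq => h.2 ?_
    have heq' : closure {(⟨p (Fin.castSucc i), hmem _⟩ : F)} =
        closure {(⟨p i.succ, hmem _⟩ : F)} :=
      congrArg (fun C : IrreducibleCloseds F => (C : Set F)) heq
    exact heq'.symm.subset
  let q : LTSeries (IrreducibleCloseds F) := ⟨p.length, cl, hstep⟩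
  exact Order.le_krullDim_iff.2 ⟨q, hlen⟩

/-- A closed subset `F` of a scheme of dimension `≥ k` contains a point of height `≥ k` (the
generic point of the top of a chain of `k + 1` irreducible closed subsets of `F`). [folklore] -/
theorem exists_le_height_of_le_topologicalKrullDim {W : Scheme} {F : Set W} (hF : IsClosed F)
    {k : ℕ} (hk : (k : WithBot ℕ∞) ≤ topologicalKrullDim F) : ∃ w ∈ F, (k : ℕ∞) ≤ height w := by
  obtain ⟨l, hl⟩ := Order.le_krullDim_iff.1 hk
  have hval : IsClosedEmbedding (Subtype.val : F → W) := hF.isClosedEmbedding_subtypeVal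
  let c : IrreducibleCloseds F → IrreducibleCloseds W := fun C =>
    { carrier := Subtype.val '' (C : Set F)
      isIrreducible' := C.isIrreducible'.image _ continuous_subtype_val.continuousOn
      isClosed' := hval.isClosedMap _ C.isClosed' }
  have hc : StrictMono c := by
    intro C C' hCC'
    have h1 : (C : Set F) ⊂ (C' : Set F) := SetLike.coe_ssubset_coe.2 hCC'
    rw [← SetLike.coe_ssubset_coe]
    change Subtype.val '' (C : Set F) ⊂ Subtype.val '' (C' : Set F)
    exact Subtype.val_injective.image_strictMono h1
  let e := irreducibleSetEquivPoints (α := W)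
  let l' : LTSeries W := (l.map c hc).map e e.strictMono
  have hlast : l'.last ∈ F := by
    have h1 : l'.last = e (c l.last) := by
      simp only [l', LTSeries.last_map]
    have h2 : e (c l.last) ∈ (c l.last : Set W) :=
      ((c l.last).isIrreducible'.isGenericPoint_genericPoint (c l.last).isClosed').mem
    obtain ⟨x, -, hx⟩ := h2
    rw [h1, ← hx]
    exact x.2
  refine ⟨l'.last, hlast, ?_⟩
  have h := Order.length_le_height (le_refl l'.last)
  simpa [l', hl] using h

/-- **Dimension `< k` iff all heights `< k`** for a closed subset of a scheme. [folklore] -/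
theorem topologicalKrullDim_lt_iff_forall_height_lt {W : Scheme} {F : Set W} (hF : IsClosed F)
    (k : ℕ) : topologicalKrullDim F < (k : WithBot ℕ∞) ↔ ∀ w ∈ F, height w < (k : ℕ∞) := by
  constructor
  · intro h w hw
    by_contra hkw
    exact (lt_irrefl _) ((le_topologicalKrullDim_of_le_height hF hw (not_lt.1 hkw)).trans_lt h)
  · intro h
    by_contra hk
    obtain ⟨w, hw, hkw⟩ := exists_le_height_of_le_topologicalKrullDim hF (not_lt.1 hk)
    exact (lt_irrefl _) (hkw.trans_lt (h w hw))

/-! ### Fibres of the projection `𝒵 → T` over complex points are the slices -/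

variable {𝒳 : Motives.SchemeOver ℂ}

/-- `height x + p ≤ n ↔ height x < n + 1 - p` (truncated subtraction; both sides are false for a
point of infinite height, and for `p > n`). [folklore] -/
theorem height_add_le_iff_lt_sub (a : ℕ∞) (p n : ℕ) :
    a + p ≤ (n : ℕ∞) ↔ a < ((n + 1 - p : ℕ) : ℕ∞) := by
  induction a using ENat.recTopCoe with
  | top => simp
  | coe m =>
    norm_cast
    omega

/-- **The fibre of `𝒵 ⊆ 𝒳 × T` over a complex point `y` of `T` has dimension `< k` iff every point
`x` of `𝒳` with `(x, y) ∈ 𝒵` has `dim closure {x} < k`**: the fibre `{w ∈ 𝒵 | pr_T w = pt y}` is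
closed, its points are the `i_y(x)` (`exists_sliceAt_base_eq`) with `height i_y(x) = height x`
(`height_sliceAt_base_eq`), and a closed subset of a scheme has dimension `< k` iff all its points
have height `< k` (`topologicalKrullDim_lt_iff_forall_height_lt`). [folklore] -/
theorem topologicalKrullDim_fibre_lt_iff {T : Motives.SchemeOver ℂ} [LocallyOfFiniteType T.hom]
    {𝒵 : Set (𝒳 ⊗ T).left} (h𝒵 : IsClosed 𝒵) (y : Motives.ComplexPoints T) (k : ℕ) :
    topologicalKrullDim {w : (𝒳 ⊗ T).left | w ∈ 𝒵 ∧
        (CartesianMonoidalCategory.snd 𝒳 T).left.base w = y.pt} < (k : WithBot ℕ∞) ↔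
      ∀ x : 𝒳.left, (sliceAt 𝒳 y).left.base x ∈ 𝒵 → height x < (k : ℕ∞) := by
  have hF : IsClosed {w : (𝒳 ⊗ T).left | w ∈ 𝒵 ∧
      (CartesianMonoidalCategory.snd 𝒳 T).left.base w = y.pt} :=
    h𝒵.inter ((Motives.ComplexPoints.isClosed_pt y).preimage
      (CartesianMonoidalCategory.snd 𝒳 T).left.continuous)
  rw [topologicalKrullDim_lt_iff_forall_height_lt hF k]
  constructor
  · intro h x hx
    rw [← height_sliceAt_base_eq y x]
    exact h _ ⟨hx, snd_sliceAt_base y x⟩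
  · rintro h w ⟨hw𝒵, hwy⟩
    obtain ⟨x, rfl⟩ := exists_sliceAt_base_eq y w hwy
    rw [height_sliceAt_base_eq y x]
    exact h x hw𝒵

/-- **Generic uniformity of the codimension condition from upper semicontinuity of fibre
dimension.** If `y ↦ dim {w ∈ 𝒵 | pr_T w = y}` is upper semicontinuous on `T` (Chevalley,
EGA IV₃ 13.1.5, for the proper `𝒵 → T`), then on every irreducible closed `Y ⊆ T` the condition
"every `x` with `(x, y) ∈ 𝒵` has `height x + p ≤ n`" holds either at all complex points of a
non-empty open part of `Y` or at none. [cite: EGAIV3, Thm. 13.1.3 and Cor. 13.1.5] -/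
theorem codim_dichotomy_of_upperSemicontinuous {T : Motives.SchemeOver ℂ}
    [LocallyOfFiniteType T.hom] {𝒵 : Set (𝒳 ⊗ T).left} (h𝒵 : IsClosed 𝒵)
    (hU : ∀ k : ℕ, IsOpen {y : T.left | topologicalKrullDim {w : (𝒳 ⊗ T).left | w ∈ 𝒵 ∧
      (CartesianMonoidalCategory.snd 𝒳 T).left.base w = y} < (k : WithBot ℕ∞)})
    (p n : ℕ) {Y : Set T.left} (hY : IsIrreducible Y) :
    ∃ O : T.left.Opens, (Y ∩ (O : Set T.left)).Nonempty ∧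
      ((∀ y : Motives.ComplexPoints T, y.pt ∈ Y ∧ y.pt ∈ (O : Set T.left) →
          ∀ x : 𝒳.left, (sliceAt 𝒳 y).left.base x ∈ 𝒵 → height x + p ≤ (n : ℕ∞)) ∨
        (∀ y : Motives.ComplexPoints T, y.pt ∈ Y ∧ y.pt ∈ (O : Set T.left) →
          ¬ ∀ x : 𝒳.left, (sliceAt 𝒳 y).left.base x ∈ 𝒵 → height x + p ≤ (n : ℕ∞))) := by
  let O : T.left.Opens := ⟨_, hU (n + 1 - p)⟩
  have key : ∀ y : Motives.ComplexPoints T, y.pt ∈ (O : Set T.left) ↔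
      ∀ x : 𝒳.left, (sliceAt 𝒳 y).left.base x ∈ 𝒵 → height x + p ≤ (n : ℕ∞) := fun y => by
    simp only [height_add_le_iff_lt_sub]
    exact topologicalKrullDim_fibre_lt_iff h𝒵 y (n + 1 - p)
  by_cases hYO : (Y ∩ (O : Set T.left)).Nonempty
  · exact ⟨O, hYO, Or.inl fun y hy => (key y).1 hy.2⟩
  · refine ⟨⊤, ?_, Or.inr fun y hy hgood => hYO ⟨y.pt, hy.1, (key y).2 hgood⟩⟩
    rw [TopologicalSpace.Opens.coe_top, Set.inter_univ]
    exact hY.nonempty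

end HodgeTheory

end Literature.AlgebraicGeometry.HodgeTheory

end
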